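import Literature.NumberTheory.Transcendental.ComplexFormsTopType
import HarnessLib

/-!
# No forms of type `(p, 0)` or `(0, q)` beyond the dimension: `Λ^{p,0} E^* = 0` for `p > dim_ℂ E`

Topic: complex-valued forms on complex manifolds (`Literature/NumberTheory/Transcendental/ComplexForms.lean`,
predicate `IsOfType p q`: the pointwise weight condition
`α(e^{iθ}v₁, …, e^{iθ}v_k) = e^{i(p-q)θ} α(v₁, …, v_k)`; `hodgePQ E M k p q ⊆ H^k_dR(M; ℂ)`: the span of
the classes of closed forms of type `(p, q)`). Companion to `ComplexFormsTopType`, which proves that a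
real-alternating `k`-form of weight `k` is `ℂ`-linear in every slot (`apply_update_I_smul_of_weight`:
`Λ^{k,0} = Λ^k_ℂ (E^{1,0})^*`, Voisin (2002), §2.3.1). Here the immediate consequence (all proved):

* `apply_eq_zero_of_forall_update_I_of_not_linearIndependent`: a real-alternating form which is
  `ℂ`-linear in every slot vanishes on every `ℂ`-linearly dependent family (it is a `ℂ`-multilinear
  alternating map; Mathlib `AlternatingMap.map_linearDependent`);
* `eq_zero_of_weight_of_finrank_lt`: **a real-alternating `k`-form of weight `k` on a complex vector
  space of dimension `< k` is zero** (`Λ^k_ℂ (E^{1,0})^* = 0` for `k > dim_ℂ E`);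
* `IsOfType.eq_zero_of_finrank_lt_left/right`: on a manifold charted on `E`, forms of type `(p, 0)`
  with `p > dim_ℂ E`, or of type `(0, q)` with `q > dim_ℂ E` (by conjugation, `IsOfType.conj`), vanish;
* `hodgePQ_eq_bot_of_finrank_lt_left/right`: hence `H^{p,0} = 0` and `H^{0,q} = 0` in `H^k_dR(M; ℂ)`
  for `p, q > dim_ℂ E` — in particular a compact complex manifold of dimension `n` has no non-zero
  holomorphic `p`-forms for `p > n` (Voisin (2002), §2.3.1: `Ω^{p,q}_X = Λ^p Ω^{1,0} ⊗ Λ^q Ω^{0,1}`,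
  and `Λ^p` of a rank-`n` bundle vanishes for `p > n`).

* `continuousAlternatingMap_eq_zero_of_finrank_real_lt`, `mform_eq_zero_of_finrank_real_lt`,
  `mform_eq_zero_of_two_mul_finrank_lt`, `hodgePQ_eq_bot_of_two_mul_finrank_lt`: the coarser, type-free
  vanishing **`Λ^k_ℝ E^* ⊗ ℂ = 0` for `k > dim_ℝ E = 2 dim_ℂ E`** — every complex-valued real-alternating
  `k`-form, hence every `k`-form on a manifold charted on `E` and every `H^{p,q} ⊆ H^k_dR(M; ℂ)`, vanishes
  in degrees `k > 2 dim_ℂ E` (any `k` vectors are `ℝ`-linearly dependent; Voisin (2002), §2.3.1 with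
  Rem. 2.24: `Ω^k_{X,ℂ} = ⊕_{p+q=k} Ω^{p,q}`, `p, q ≤ n`, so `Ω^k_{X,ℂ} = 0` for `k > 2n`).

Consumer: `Literature.AlgebraicGeometry.HodgeTheory` (`HodgeModel.hodgePQ_eq_bot_of_lt_left`: no
classes of Hodge type `(p, 0)`, `p > n`, on an `n`-dimensional smooth projective variety — the step
"`j̃^* η = 0` in `H⁰(X̃', Ω^r)` as `dim X̃' < r`" of Voisin II, proof of Thm. 10.17). Mixed types
`(p, q)` with `p > n`, `0 < q` are not treated (the weight `p - q` alone does not detect them).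

## References

* C. Voisin, *Hodge Theory and Complex Algebraic Geometry I* (2002), §2.3.1 (eq. (2.4):
  `Ω^{p,q} = Λ^p Ω^{1,0} ⊗ Λ^q Ω^{0,1}`).
* R. O. Wells, *Differential Analysis on Complex Manifolds* (1980), Ch. I §3.
* Mathlib: `AlternatingMap.map_linearDependent`, `LinearIndependent.fintype_card_le_finrank`.
-/

noncomputable section

open scoped Manifold ContDiff Topology
open Set Function Finset

namespace Literature.NumberTheory.Transcendental

/-! ### Pointwise: `ℂ`-multilinear alternating forms in too many slots vanish -/

section Pointwise

variable {E : Type*} [NormedAddCommGroup E] [NormedSpace ℂ E] {k : ℕ}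

/-- A real-alternating complex-valued form which is `ℂ`-linear in every slot (for the scalar `i`,
hence for all complex scalars, `map_update_smul_complex_of_forall_update_I`) is a `ℂ`-multilinear
alternating map, so it vanishes on every `ℂ`-linearly dependent family
(`AlternatingMap.map_linearDependent`). [folklore] -/
theorem apply_eq_zero_of_forall_update_I_of_not_linearIndependent (φ : E [⋀^Fin k]→L[ℝ] ℂ)
    (hI : ∀ (v : Fin k → E) (j : Fin k), φ (update v j (Complex.I • v j)) = Complex.I * φ v)
    (v : Fin k → E) (hv : ¬ LinearIndependent ℂ v) : φ v = 0 := by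
  let ψ : E [⋀^Fin k]→ₗ[ℂ] ℂ :=
    { toFun := φ
      map_update_add' := fun v i x y ↦ φ.map_update_add v i x y
      map_update_smul' := fun v i c x ↦ by
        convert map_update_smul_complex_of_forall_update_I φ hI v i c x
      map_eq_zero_of_eq' := fun v i j h hij ↦ φ.map_eq_zero_of_eq v h hij }
  have hψ : ψ v = φ v := rfl
  rw [← hψ]
  exact ψ.map_linearDependent v hv

/-- **`Λ^k_ℂ (E^{1,0})^* = 0` for `k > dim_ℂ E`**: on a complex vector space of dimension `< k`, a
real-alternating complex-valued `k`-form of weight `k` under the rotations `e^{iθ}` (type `(k, 0)`) is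
zero — it is `ℂ`-linear in every slot (`apply_update_I_smul_of_weight`), and any `k` vectors are
`ℂ`-linearly dependent (`LinearIndependent.fintype_card_le_finrank`). Voisin (2002), §2.3.1.
[cite: VoisinHodgeI2002, §2.3.1] -/
theorem eq_zero_of_weight_of_finrank_lt [FiniteDimensional ℂ E] (φ : E [⋀^Fin k]→L[ℝ] ℂ)
    (hφ : ∀ (θ : ℝ) (v : Fin k → E), φ (fun i ↦ Complex.exp (θ * Complex.I) • v i) =
      Complex.exp ((k : ℂ) * θ * Complex.I) * φ v)
    (hk : Module.finrank ℂ E < k) : φ = 0 := by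
  cases k with
  | zero => exact absurd hk (Nat.not_lt_zero _)
  | succ m =>
    ext v
    refine apply_eq_zero_of_forall_update_I_of_not_linearIndependent φ
      (apply_update_I_smul_of_weight φ hφ) v fun hv ↦ ?_
    have h := hv.fintype_card_le_finrank
    rw [Fintype.card_fin] at h
    omega

end Pointwise

/-! ### Forms of type `(p, 0)`, `p > dim`, and `(0, q)`, `q > dim`, vanish -/

section Forms

variable {E : Type*} [NormedAddCommGroup E] [NormedSpace ℂ E] [FiniteDimensional ℂ E]
  {M : Type*} [TopologicalSpace M] [ChartedSpace E M] {k : ℕ}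

/-- **No non-zero forms of type `(p, 0)` with `p > dim_ℂ E`** on a manifold charted on `E`
(pointwise `eq_zero_of_weight_of_finrank_lt` on each tangent space `T_x M = E`).
Voisin (2002), §2.3.1 (`Ω^{p,0} = Λ^p Ω^{1,0}`). [cite: VoisinHodgeI2002, §2.3.1] -/
theorem IsOfType.eq_zero_of_finrank_lt_left {p : ℕ} {α : Literature.Geometry.Kaehler.MForm 𝓘(ℝ, E) M ℂ k}
    (hα : IsOfType p 0 α) (hp : Module.finrank ℂ E < p) : α = 0 := by
  obtain ⟨hpk, hw⟩ := hα
  rw [add_zero] at hpk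
  subst hpk
  funext x
  have he : (((p : ℤ) - (0 : ℕ) : ℤ) : ℂ) = (p : ℂ) := by push_cast; ring
  have hφ : ∀ (θ : ℝ) (v : Fin p → E),
      (show E [⋀^Fin p]→L[ℝ] ℂ from α x) (fun i ↦ Complex.exp (θ * Complex.I) • v i) =
        Complex.exp ((p : ℂ) * θ * Complex.I) * (show E [⋀^Fin p]→L[ℝ] ℂ from α x) v := by
    intro θ v
    have h := hw x θ v
    rw [he] at h
    exact h
  exact eq_zero_of_weight_of_finrank_lt (show E [⋀^Fin p]→L[ℝ] ℂ from α x) hφ hp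

/-- **No non-zero forms of type `(0, q)` with `q > dim_ℂ E`**: the conjugate form has type `(q, 0)`
(`IsOfType.conj`) and vanishes. Voisin (2002), §2.3.1 (`Ω^{0,q} = Λ^q Ω^{0,1} = conj Λ^q Ω^{1,0}`).
[cite: VoisinHodgeI2002, §2.3.1] -/
theorem IsOfType.eq_zero_of_finrank_lt_right {q : ℕ} {α : Literature.Geometry.Kaehler.MForm 𝓘(ℝ, E) M ℂ k}
    (hα : IsOfType 0 q α) (hq : Module.finrank ℂ E < q) : α = 0 := by
  have h : α.conj = 0 := hα.conj.eq_zero_of_finrank_lt_left hq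
  rw [← α.conj_conj, h, Literature.Geometry.Kaehler.MForm.conj_zero]

variable (M) in
/-- **`H^{p,0} = 0` in `H^k_dR(M; ℂ)` for `p > dim_ℂ E`**: the span of the classes of closed forms of
type `(p, 0)` is `⊥`, all such forms being `0`. For `M` compact Kähler of dimension `n` and `k = p`:
there are no non-zero holomorphic `p`-forms for `p > n`. [cite: VoisinHodgeI2002, §2.3.1] -/
theorem hodgePQ_eq_bot_of_finrank_lt_left {p : ℕ} (hp : Module.finrank ℂ E < p) :
    hodgePQ E M k p 0 = ⊥ := by
  rw [hodgePQ, Submodule.span_eq_bot]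
  rintro _ ⟨α, hα, rfl⟩
  have h0 : α = 0 :=
    Subtype.ext (IsOfType.eq_zero_of_finrank_lt_left (α := (α : Literature.Geometry.Kaehler.MForm 𝓘(ℝ, E) M ℂ k)) hα hp)
  rw [h0, map_zero]

variable (M) in
/-- **`H^{0,q} = 0` in `H^k_dR(M; ℂ)` for `q > dim_ℂ E`** (conjugate statement).
[cite: VoisinHodgeI2002, §2.3.1] -/
theorem hodgePQ_eq_bot_of_finrank_lt_right {q : ℕ} (hq : Module.finrank ℂ E < q) :
    hodgePQ E M k 0 q = ⊥ := by
  rw [hodgePQ, Submodule.span_eq_bot]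
  rintro _ ⟨α, hα, rfl⟩
  have h0 : α = 0 :=
    Subtype.ext (IsOfType.eq_zero_of_finrank_lt_right (α := (α : Literature.Geometry.Kaehler.MForm 𝓘(ℝ, E) M ℂ k)) hα hq)
  rw [h0, map_zero]

end Forms

/-! ### Forms of degree `k > dim_ℝ E = 2 dim_ℂ E` vanish (no type condition) -/

section RealRank

variable {E : Type*} [NormedAddCommGroup E] [NormedSpace ℂ E] [FiniteDimensional ℂ E] {k : ℕ}

/-- **`Λ^k_ℝ E^* ⊗ ℂ = 0` for `k > dim_ℝ E`**: a complex-valued real-alternating `k`-form on a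
finite-dimensional space `E` with `dim_ℝ E < k` is zero, since any `k` vectors of `E` are `ℝ`-linearly
dependent (`LinearIndependent.fintype_card_le_finrank`) and an alternating map kills linearly dependent
families (`AlternatingMap.map_linearDependent`). [folklore] -/
theorem continuousAlternatingMap_eq_zero_of_finrank_real_lt (φ : E [⋀^Fin k]→L[ℝ] ℂ)
    (hk : Module.finrank ℝ E < k) : φ = 0 := by
  ext v
  have hv : ¬ LinearIndependent ℝ v := fun hv ↦ by
    have h := hv.fintype_card_le_finrank
    rw [Fintype.card_fin] at h
    omega
  exact φ.toAlternatingMap.map_linearDependent v hv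

variable {M : Type*} [TopologicalSpace M] [ChartedSpace E M]

/-- **No non-zero `k`-forms for `k > dim_ℝ E`** on a manifold charted on `E` (pointwise
`continuousAlternatingMap_eq_zero_of_finrank_real_lt` on each tangent space `T_x M = E`). [folklore] -/
theorem mform_eq_zero_of_finrank_real_lt (α : Literature.Geometry.Kaehler.MForm 𝓘(ℝ, E) M ℂ k)
    (hk : Module.finrank ℝ E < k) : α = 0 := by
  funext x
  exact continuousAlternatingMap_eq_zero_of_finrank_real_lt (show E [⋀^Fin k]→L[ℝ] ℂ from α x) hk

/-- **No non-zero `k`-forms for `k > 2 dim_ℂ E`** on a manifold charted on the complex space `E`: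
`dim_ℝ E = 2 dim_ℂ E` (Mathlib `finrank_real_of_complex`). Voisin (2002), §2.3.1, Rem. 2.24:
`Ω^k_{X,ℂ} = ⊕_{p+q=k} Ω^{p,q}_X` with `Ω^{p,q} = Λ^p Ω^{1,0} ⊗ Λ^q Ω^{0,1}` zero unless `p, q ≤ n`, so
`Ω^k_{X,ℂ} = 0` for `k > 2n`. [cite: VoisinHodgeI2002, §2.3.1] -/
theorem mform_eq_zero_of_two_mul_finrank_lt (α : Literature.Geometry.Kaehler.MForm 𝓘(ℝ, E) M ℂ k)
    (hk : 2 * Module.finrank ℂ E < k) : α = 0 :=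
  mform_eq_zero_of_finrank_real_lt α (by rw [finrank_real_of_complex]; exact hk)

variable (M) in
/-- **`H^{p,q} = 0` in `H^k_dR(M; ℂ)` for every `(p, q)` once `k > 2 dim_ℂ E`**: the span of the classes
of closed `k`-forms of type `(p, q)` is `⊥`, all `k`-forms being `0`. For `M` compact Kähler of
dimension `n`: `H^k(M, ℂ) = ⊕_{p+q=k} H^{p,q} = 0` for `k > 2n`. [cite: VoisinHodgeI2002, §2.3.1] -/
theorem hodgePQ_eq_bot_of_two_mul_finrank_lt (hk : 2 * Module.finrank ℂ E < k) (p q : ℕ) :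
    hodgePQ E M k p q = ⊥ := by
  rw [hodgePQ, Submodule.span_eq_bot]
  rintro _ ⟨α, _, rfl⟩
  have h0 : α = 0 :=
    Subtype.ext (mform_eq_zero_of_two_mul_finrank_lt (α : Literature.Geometry.Kaehler.MForm 𝓘(ℝ, E) M ℂ k) hk)
  rw [h0, map_zero]

end RealRank

end Literature.NumberTheory.Transcendental

end
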